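import Mathlib.Analysis.Calculus.BumpFunction.Convolution
import Mathlib.Analysis.Calculus.BumpFunction.FiniteDimension
import Mathlib.Analysis.Calculus.ContDiff.Convolution
import Mathlib.MeasureTheory.Measure.Haar.NormedSpace
import HarnessLib

/-!
# Smooth cut-off functions of a set at scale `δ` with derivative bound `C/δ`

Analysis/FunctionSpaces support file (theorem-only). The standard cut-off of De Rosa–Isett's
Lemma 5.2 (ARMA 248 (2024) = arXiv:2212.08176: "`χ_δ = 𝟙_{(S)_{2δ,2δ}} ∗_{x,t} ρ_δ` satisfies all the
claimed properties", namely `χ_δ ≡ 1` on `(S)_δ`, `χ_δ ≡ 0` off `(S)_{4δ}`, `|∇χ_δ| ≲ δ⁻¹`), on a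
finite-dimensional real normed space `G` with an additive Haar measure `μ`: for a set `A ⊆ G` and a
scale `δ > 0`, the mollification

  `χ = K_δ ⋆ 𝟙_A`,  `K_δ(z) = δ^{-N} ρ₁(z/δ)`, `N = dim G`,

of the indicator of `A` by the rescaling of one fixed normalised bump `ρ₁` (supported in the unit
ball) is smooth, takes values in `[0,1]`, equals `1` at points whose `δ`-ball lies in `A` and `0` at
points whose `δ`-ball misses `A`, and has `‖Dχ‖ ≤ C₁/δ` everywhere, `C₁ = ∫ ‖Dρ₁‖`
(`exists_smooth_cutoff`, `exists_smooth_cutoff_of_bump`). Balls are those of the norm of `G` (for `G = ℝ × ℝ^d` with the product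
sup norm: space–time cylinders, matching the sup-metric neighbourhoods `(S)_{δ,δ}` of the tree's
`Literature.Barriers.AnomalousDissipation.DeRosaIsett2024_thm27`).

## Mathlib search

Mathlib (this pin): `ContDiffBump.normed` (`contDiff_normed`, `integral_normed`,
`support_normed_eq`), `HasCompactSupport.contDiff_convolution_left`,
`HasCompactSupport.hasFDerivAt_convolution_left`, `convolution_eq_right'`,
`Measure.integral_comp_inv_smul`, and the existence of bump functions on finite-dimensional spaces
(`BumpFunction/FiniteDimension`); the density statement `ContinuousMap.dense_setOf_contDiff`
(`BumpFunction/SmoothApprox`) has no derivative bound — the scale-`δ` family with `‖Dχ‖ ≤ C/δ` is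
supplied here.

## References

* L. De Rosa, P. Isett, Arch. Ration. Mech. Anal. 248 (2024), Paper No. 11, Lemma 5.2. [DeRosaIsett2024]
* L. C. Evans, *Partial Differential Equations*, 2nd ed. (AMS 2010), App. C.4 Thm. 7. [Evans2010]
-/

noncomputable section

open MeasureTheory Set Filter Topology Function Metric ContinuousLinearMap Module
open scoped ENNReal NNReal Convolution ContDiff

namespace Literature.Analysis.FunctionSpaces

variable {G : Type*} [NormedAddCommGroup G] [NormedSpace ℝ G] [FiniteDimensional ℝ G]
  [MeasurableSpace G] [BorelSpace G] (μ : Measure G) [μ.IsAddHaarMeasure]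

/-! ## The rescaled kernel `K_δ(z) = δ^{-N} ρ(δ⁻¹ z)` of a bump `ρ` -/

section Kernel

variable {μ}
variable {ρ : G → ℝ} {δ : ℝ}

omit [BorelSpace G] [μ.IsAddHaarMeasure] [FiniteDimensional ℝ G] [MeasurableSpace G] in
/-- The rescaled kernel of a nonnegative bump is nonnegative. [folklore] -/
theorem scaledKernel_nonneg (hρ0 : ∀ z, 0 ≤ ρ z) (hδ : 0 < δ) (N : ℕ) (z : G) :
    0 ≤ (δ ^ N)⁻¹ * ρ (δ⁻¹ • z) :=
  mul_nonneg (inv_nonneg.2 (pow_nonneg hδ.le _)) (hρ0 _)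

omit [BorelSpace G] [μ.IsAddHaarMeasure] [FiniteDimensional ℝ G] [MeasurableSpace G] in
/-- The rescaled kernel of a `C^n` bump is `C^n`. [folklore] -/
theorem contDiff_scaledKernel {n : ℕ∞} (hρs : ContDiff ℝ n ρ) (δ : ℝ) (N : ℕ) :
    ContDiff ℝ n (fun z : G => (δ ^ N)⁻¹ * ρ (δ⁻¹ • z)) :=
  contDiff_const.mul (hρs.comp (contDiff_const_smul _))

omit [BorelSpace G] [μ.IsAddHaarMeasure] [FiniteDimensional ℝ G] [MeasurableSpace G] in
/-- The rescaled kernel is supported in `B(0, δ)`. [folklore] -/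
theorem support_scaledKernel_subset (hρsupp : support ρ ⊆ ball 0 1) (hδ : 0 < δ) (N : ℕ) :
    support (fun z : G => (δ ^ N)⁻¹ * ρ (δ⁻¹ • z)) ⊆ ball 0 δ := by
  intro z hz
  rw [mem_support, mul_ne_zero_iff] at hz
  have h2 : δ⁻¹ • z ∈ support ρ := hz.2
  have h3 : ‖δ⁻¹ • z‖ < 1 := by simpa using hρsupp h2
  rw [norm_smul, norm_inv, Real.norm_of_nonneg hδ.le, inv_mul_lt_iff₀ hδ, mul_one] at h3
  exact mem_ball_zero_iff.2 h3

omit [BorelSpace G] [μ.IsAddHaarMeasure] [MeasurableSpace G] in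
/-- The rescaled kernel has compact support. [folklore] -/
theorem hasCompactSupport_scaledKernel (hρsupp : support ρ ⊆ ball 0 1) (hδ : 0 < δ) (N : ℕ) :
    HasCompactSupport (fun z : G => (δ ^ N)⁻¹ * ρ (δ⁻¹ • z)) :=
  HasCompactSupport.of_support_subset_isCompact (isCompact_closedBall 0 δ)
    ((support_scaledKernel_subset hρsupp hδ N).trans ball_subset_closedBall)

/-- The rescaled kernel has unit mass (`∫ f(δ⁻¹z) dz = δ^N ∫ f`). [folklore] -/
theorem integral_scaledKernel (hρ1 : ∫ z, ρ z ∂μ = 1) (hδ : 0 < δ) :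
    ∫ z, (δ ^ finrank ℝ G)⁻¹ * ρ (δ⁻¹ • z) ∂μ = 1 := by
  rw [integral_const_mul, Measure.integral_comp_inv_smul μ, hρ1, smul_eq_mul,
    mul_one, abs_of_pos (pow_pos hδ _), inv_mul_cancel₀ (pow_pos hδ _).ne']

/-- The derivative of the rescaled kernel has `L¹` norm `≤ δ⁻¹ ∫ ‖Dρ‖`. [folklore] -/
theorem integral_norm_fderiv_scaledKernel_le (hρs : ContDiff ℝ 1 ρ) (hρc : HasCompactSupport ρ)
    (hδ : 0 < δ) :
    ∫ z, ‖fderiv ℝ (fun z : G => (δ ^ finrank ℝ G)⁻¹ * ρ (δ⁻¹ • z)) z‖ ∂μ ≤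
      δ⁻¹ * ∫ z, ‖fderiv ℝ ρ z‖ ∂μ := by
  have hρd : Differentiable ℝ ρ := hρs.differentiable one_ne_zero
  set N := finrank ℝ G with hN
  set K : G → ℝ := fun z => (δ ^ N)⁻¹ * ρ (δ⁻¹ • z) with hK
  -- the derivative pointwise
  have hderiv : ∀ z, fderiv ℝ K z =
      (δ ^ N)⁻¹ • (fderiv ℝ ρ (δ⁻¹ • z)).comp (δ⁻¹ • ContinuousLinearMap.id ℝ G) := by
    intro z
    have h1 : HasFDerivAt (fun w => ρ (δ⁻¹ • w)) ((fderiv ℝ ρ (δ⁻¹ • z)).comp (δ⁻¹ • ContinuousLinearMap.id ℝ G)) z := by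
      have hl : HasFDerivAt (fun w : G => δ⁻¹ • w) (δ⁻¹ • ContinuousLinearMap.id ℝ G) z :=
        (δ⁻¹ • ContinuousLinearMap.id ℝ G).hasFDerivAt
      exact (hρd (δ⁻¹ • z)).hasFDerivAt.comp z hl
    have h2 : HasFDerivAt K ((δ ^ N)⁻¹ • (fderiv ℝ ρ (δ⁻¹ • z)).comp (δ⁻¹ • ContinuousLinearMap.id ℝ G)) z := by
      have := h1.const_smul ((δ ^ N)⁻¹)
      exact this
    exact h2.fderiv
  have hbound : ∀ z, ‖fderiv ℝ K z‖ ≤ (δ ^ N)⁻¹ * (δ⁻¹ * ‖fderiv ℝ ρ (δ⁻¹ • z)‖) := by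
    intro z
    rw [hderiv z, norm_smul, norm_inv, norm_pow, Real.norm_of_nonneg hδ.le]
    refine mul_le_mul_of_nonneg_left ?_ (by positivity)
    calc ‖(fderiv ℝ ρ (δ⁻¹ • z)).comp (δ⁻¹ • ContinuousLinearMap.id ℝ G)‖
        ≤ ‖fderiv ℝ ρ (δ⁻¹ • z)‖ * ‖δ⁻¹ • ContinuousLinearMap.id ℝ G‖ := opNorm_comp_le _ _
      _ ≤ ‖fderiv ℝ ρ (δ⁻¹ • z)‖ * δ⁻¹ := by
          gcongr
          rw [norm_smul, norm_inv, Real.norm_of_nonneg hδ.le]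
          exact mul_le_of_le_one_right (by positivity) norm_id_le
      _ = δ⁻¹ * ‖fderiv ℝ ρ (δ⁻¹ • z)‖ := mul_comm _ _
  have hint : Integrable (fun z => ‖fderiv ℝ ρ (δ⁻¹ • z)‖) μ := by
    have hc : Continuous fun z => ‖fderiv ℝ ρ z‖ := (hρs.continuous_fderiv one_ne_zero).norm
    have hcs : HasCompactSupport fun z => ‖fderiv ℝ ρ z‖ := (hρc.fderiv ℝ).norm
    have hi : Integrable (fun z => ‖fderiv ℝ ρ z‖) μ := hc.integrable_of_hasCompactSupport hcs
    exact hi.comp_smul (inv_ne_zero hδ.ne')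
  calc ∫ z, ‖fderiv ℝ K z‖ ∂μ
      ≤ ∫ z, (δ ^ N)⁻¹ * (δ⁻¹ * ‖fderiv ℝ ρ (δ⁻¹ • z)‖) ∂μ :=
        integral_mono_of_nonneg (ae_of_all _ fun z => norm_nonneg _) ((hint.const_mul _).const_mul _)
          (ae_of_all _ hbound)
    _ = (δ ^ N)⁻¹ * (δ⁻¹ * (|δ ^ N| * ∫ z, ‖fderiv ℝ ρ z‖ ∂μ)) := by
        rw [integral_const_mul, integral_const_mul,
          Measure.integral_comp_inv_smul μ (fun y => ‖fderiv ℝ ρ y‖) δ, smul_eq_mul]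
    _ = δ⁻¹ * ∫ z, ‖fderiv ℝ ρ z‖ ∂μ := by
        rw [abs_of_pos (pow_pos hδ _)]
        field_simp

end Kernel

/-! ## The cut-off -/

section Cutoff

variable {μ}

set_option maxSynthPendingDepth 2 in
/-- **Smooth cut-off from a given bump** (the construction `χ = K_δ ⋆ 𝟙_A`): for a smooth
compactly supported `ρ ≥ 0` with `supp ρ ⊆ B(0,1)`, `∫ρ = 1`, a measurable `A ⊆ G` and `δ > 0`,
the mollification of `𝟙_A` by `K_δ(z) = δ^{-N}ρ(δ⁻¹z)` is smooth, `[0,1]`-valued, `= 1` where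
`B(x,δ) ⊆ A`, `= 0` where `B(x,δ) ∩ A = ∅`, and `‖Dχ‖ ≤ δ⁻¹ ∫‖Dρ‖`. [cite: DeRosaIsett2024, Lemma 5.2] -/
theorem exists_smooth_cutoff_of_bump {ρ : G → ℝ} (hρs : ContDiff ℝ ∞ ρ) (hρc : HasCompactSupport ρ)
    (hρsupp : support ρ ⊆ ball 0 1) (hρ0 : ∀ z, 0 ≤ ρ z) (hρ1 : ∫ z, ρ z ∂μ = 1)
    {A : Set G} (hA : MeasurableSet A) {δ : ℝ} (hδ : 0 < δ) :
    ∃ χ : G → ℝ, ContDiff ℝ ∞ χ ∧ (∀ x, 0 ≤ χ x ∧ χ x ≤ 1) ∧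
      (∀ x, ball x δ ⊆ A → χ x = 1) ∧ (∀ x, Disjoint (ball x δ) A → χ x = 0) ∧
      ∀ x, ‖fderiv ℝ χ x‖ ≤ δ⁻¹ * ∫ z, ‖fderiv ℝ ρ z‖ ∂μ := by
  set K : G → ℝ := fun z => (δ ^ finrank ℝ G)⁻¹ * ρ (δ⁻¹ • z) with hK
  set g : G → ℝ := A.indicator fun _ => (1 : ℝ) with hg
  have hg01 : ∀ x, 0 ≤ g x ∧ g x ≤ 1 := fun x => by
    by_cases hx : x ∈ A <;> simp [hg, hx]
  have hgli : LocallyIntegrable g μ := (locallyIntegrable_const (1 : ℝ)).indicator hA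
  set χ : G → ℝ := K ⋆[lsmul ℝ ℝ, μ] g with hχ
  have hKcs : HasCompactSupport K := hasCompactSupport_scaledKernel hρsupp hδ _
  have hKcd : ContDiff ℝ ∞ K := contDiff_scaledKernel hρs δ _
  have hρ1' : ContDiff ℝ 1 ρ := hρs.of_le (mod_cast le_top)
  have hK1 : ContDiff ℝ 1 K := contDiff_scaledKernel hρ1' δ _
  have hKsupp : support K ⊆ ball 0 δ := support_scaledKernel_subset hρsupp hδ _
  have hKint1 : ∫ z, K z ∂μ = 1 := integral_scaledKernel hρ1 hδ
  have hK0 : ∀ z, 0 ≤ K z := scaledKernel_nonneg hρ0 hδ _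
  have hKi : Integrable K μ := (hKcd.continuous).integrable_of_hasCompactSupport hKcs
  refine ⟨χ, hKcs.contDiff_convolution_left _ hKcd hgli, fun x => ?_, fun x hx => ?_, fun x hx => ?_,
    fun x => ?_⟩
  · -- values in `[0,1]`
    have hint : Integrable (fun t => K t • g (x - t)) μ :=
      hKcs.convolutionExists_left (lsmul ℝ ℝ) hKcd.continuous hgli x
    have hχx : χ x = ∫ t, K t • g (x - t) ∂μ := convolution_lsmul
    rw [hχx]
    refine ⟨integral_nonneg fun t => smul_nonneg (hK0 t) (hg01 _).1, ?_⟩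
    calc ∫ t, K t • g (x - t) ∂μ ≤ ∫ t, K t ∂μ :=
          integral_mono hint hKi fun t => by
            rw [smul_eq_mul]
            exact mul_le_of_le_one_right (hK0 t) (hg01 _).2
      _ = 1 := hKint1
  · -- `χ = 1` where the ball lies in `A`
    have h1 : ∀ y ∈ ball x δ, g y = g x := by
      intro y hy
      have hyA : y ∈ A := hx hy
      have hxA : x ∈ A := hx (mem_ball_self hδ)
      simp [hg, hyA, hxA]
    rw [hχ, convolution_eq_right' _ hKsupp h1]
    have hxA : x ∈ A := hx (mem_ball_self hδ)
    simp only [lsmul_apply, smul_eq_mul, hg, indicator_of_mem hxA, mul_one]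
    exact hKint1
  · -- `χ = 0` where the ball misses `A`
    have h1 : ∀ y ∈ ball x δ, g y = g x := by
      intro y hy
      have hyA : y ∉ A := fun h => hx.le_bot ⟨hy, h⟩
      have hxA : x ∉ A := fun h => hx.le_bot ⟨mem_ball_self hδ, h⟩
      simp [hg, hyA, hxA]
    rw [hχ, convolution_eq_right' _ hKsupp h1]
    have hxA : x ∉ A := fun h => hx.le_bot ⟨mem_ball_self hδ, h⟩
    simp [hg, indicator_of_notMem hxA]
  · -- derivative bound
    have hD := hKcs.hasFDerivAt_convolution_left (lsmul ℝ ℝ) hK1 hgli x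
    rw [hD.fderiv, convolution_def]
    set L' : (G →L[ℝ] ℝ) →L[ℝ] ℝ →L[ℝ] (G →L[ℝ] ℝ) := (lsmul ℝ ℝ).precompL G with hL'
    have hL'n : ‖L'‖ ≤ 1 :=
      (norm_precompL_le (Eₗ := G) (lsmul ℝ ℝ : ℝ →L[ℝ] ℝ →L[ℝ] ℝ)).trans opNorm_lsmul_le
    have hKd_int : Integrable (fun t => ‖fderiv ℝ K t‖) μ :=
      ((hK1.continuous_fderiv one_ne_zero).norm).integrable_of_hasCompactSupport (hKcs.fderiv ℝ).norm
    calc ‖∫ t, L' (fderiv ℝ K t) (g (x - t)) ∂μ‖ ≤ ∫ t, ‖fderiv ℝ K t‖ ∂μ := by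
          refine norm_integral_le_of_norm_le hKd_int (ae_of_all _ fun t => ?_)
          calc ‖L' (fderiv ℝ K t) (g (x - t))‖ ≤ ‖L'‖ * ‖fderiv ℝ K t‖ * ‖g (x - t)‖ := le_opNorm₂ _ _ _
            _ ≤ 1 * ‖fderiv ℝ K t‖ * 1 := by
                gcongr
                rw [Real.norm_of_nonneg (hg01 _).1]
                exact (hg01 _).2
            _ = ‖fderiv ℝ K t‖ := by ring
      _ ≤ δ⁻¹ * ∫ z, ‖fderiv ℝ ρ z‖ ∂μ := integral_norm_fderiv_scaledKernel_le hρ1' hρc hδ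

/-- **Smooth cut-offs of sets at scale `δ` with `‖Dχ‖ ≤ C/δ`** (De Rosa–Isett 2024, Lemma 5.2;
Evans, App. C.4): there is a constant `C ≥ 0` (depending only on `G` and `μ`) such that for every
measurable `A ⊆ G` and every `δ > 0` there is `χ : G → ℝ`, smooth, `[0,1]`-valued, with `χ(x) = 1`
whenever `ball x δ ⊆ A`, `χ(x) = 0` whenever `ball x δ ∩ A = ∅`, and `‖Dχ(x)‖ ≤ C/δ` for all `x`
(`χ = K_δ ⋆ 𝟙_A` with `K_δ` the rescaling of one fixed normalised bump). [cite: DeRosaIsett2024, Lemma 5.2] -/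
theorem exists_smooth_cutoff (μ : Measure G) [μ.IsAddHaarMeasure] :
    ∃ C : ℝ, 0 ≤ C ∧ ∀ (A : Set G), MeasurableSet A → ∀ δ : ℝ, 0 < δ →
      ∃ χ : G → ℝ, ContDiff ℝ ∞ χ ∧ (∀ x, 0 ≤ χ x ∧ χ x ≤ 1) ∧
        (∀ x, ball x δ ⊆ A → χ x = 1) ∧ (∀ x, Disjoint (ball x δ) A → χ x = 0) ∧
        ∀ x, ‖fderiv ℝ χ x‖ ≤ C / δ := by
  set b : ContDiffBump (0 : G) := ⟨1 / 2, 1, by norm_num, by norm_num⟩ with hb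
  set ρ : G → ℝ := b.normed μ with hρ
  refine ⟨∫ z, ‖fderiv ℝ ρ z‖ ∂μ, integral_nonneg fun _ => norm_nonneg _, fun A hA δ hδ => ?_⟩
  have hsupp : support ρ ⊆ ball 0 1 := by
    rw [hρ, b.support_normed_eq]
  obtain ⟨χ, h1, h2, h3, h4, h5⟩ := exists_smooth_cutoff_of_bump (μ := μ) b.contDiff_normed
    b.hasCompactSupport_normed hsupp (b.nonneg_normed) b.integral_normed hA hδ
  refine ⟨χ, h1, h2, h3, h4, fun x => (h5 x).trans_eq ?_⟩
  rw [div_eq_inv_mul]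

end Cutoff


/-! ## The cut-off of a translation-invariant set is translation invariant -/

section Periodic

set_option maxSynthPendingDepth 2 in
/-- **Smooth cut-off from a given bump, with periodicity** (the construction `χ = K_δ ⋆ 𝟙_A` once
more, now recording that `χ` inherits every translation invariance of `A`): for a smooth compactly
supported `ρ ≥ 0` with `supp ρ ⊆ B(0,1)`, `∫ρ = 1`, a measurable `A ⊆ G` and `δ > 0`, there is
`χ`, smooth, `[0,1]`-valued, `= 1` where `B(x,δ) ⊆ A`, `= 0` where `B(x,δ) ∩ A = ∅`, with
`‖Dχ‖ ≤ δ⁻¹ ∫‖Dρ‖`, and `χ(x + v) = χ(x)` for every `v` with `A + v = A`. [cite: DeRosaIsett2024, Lemma 5.2] -/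
theorem exists_smooth_cutoff_of_bump_periodic {ρ : G → ℝ} (hρs : ContDiff ℝ ∞ ρ)
    (hρc : HasCompactSupport ρ) (hρsupp : support ρ ⊆ ball 0 1) (hρ0 : ∀ z, 0 ≤ ρ z)
    (hρ1 : ∫ z, ρ z ∂μ = 1) {A : Set G} (hA : MeasurableSet A) {δ : ℝ} (hδ : 0 < δ) :
    ∃ χ : G → ℝ, ContDiff ℝ ∞ χ ∧ (∀ x, 0 ≤ χ x ∧ χ x ≤ 1) ∧
      (∀ x, ball x δ ⊆ A → χ x = 1) ∧ (∀ x, Disjoint (ball x δ) A → χ x = 0) ∧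
      (∀ x, ‖fderiv ℝ χ x‖ ≤ δ⁻¹ * ∫ z, ‖fderiv ℝ ρ z‖ ∂μ) ∧
      ∀ v : G, (∀ x, x + v ∈ A ↔ x ∈ A) → ∀ x, χ (x + v) = χ x := by
  set K : G → ℝ := fun z => (δ ^ finrank ℝ G)⁻¹ * ρ (δ⁻¹ • z) with hK
  set g : G → ℝ := A.indicator fun _ => (1 : ℝ) with hg
  have hg01 : ∀ x, 0 ≤ g x ∧ g x ≤ 1 := fun x => by
    by_cases hx : x ∈ A <;> simp [hg, hx]
  have hgli : LocallyIntegrable g μ := (locallyIntegrable_const (1 : ℝ)).indicator hA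
  set χ : G → ℝ := K ⋆[lsmul ℝ ℝ, μ] g with hχ
  have hKcs : HasCompactSupport K := hasCompactSupport_scaledKernel hρsupp hδ _
  have hKcd : ContDiff ℝ ∞ K := contDiff_scaledKernel hρs δ _
  have hρ1' : ContDiff ℝ 1 ρ := hρs.of_le (mod_cast le_top)
  have hK1 : ContDiff ℝ 1 K := contDiff_scaledKernel hρ1' δ _
  have hKsupp : support K ⊆ ball 0 δ := support_scaledKernel_subset hρsupp hδ _
  have hKint1 : ∫ z, K z ∂μ = 1 := integral_scaledKernel hρ1 hδ
  have hK0 : ∀ z, 0 ≤ K z := scaledKernel_nonneg hρ0 hδ _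
  have hKi : Integrable K μ := (hKcd.continuous).integrable_of_hasCompactSupport hKcs
  refine ⟨χ, hKcs.contDiff_convolution_left _ hKcd hgli, fun x => ?_, fun x hx => ?_, fun x hx => ?_,
    fun x => ?_, fun v hv x => ?_⟩
  · -- values in `[0,1]`
    have hint : Integrable (fun t => K t • g (x - t)) μ :=
      hKcs.convolutionExists_left (lsmul ℝ ℝ) hKcd.continuous hgli x
    have hχx : χ x = ∫ t, K t • g (x - t) ∂μ := convolution_lsmul
    rw [hχx]
    refine ⟨integral_nonneg fun t => smul_nonneg (hK0 t) (hg01 _).1, ?_⟩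
    calc ∫ t, K t • g (x - t) ∂μ ≤ ∫ t, K t ∂μ :=
          integral_mono hint hKi fun t => by
            rw [smul_eq_mul]
            exact mul_le_of_le_one_right (hK0 t) (hg01 _).2
      _ = 1 := hKint1
  · -- `χ = 1` where the ball lies in `A`
    have h1 : ∀ y ∈ ball x δ, g y = g x := by
      intro y hy
      have hyA : y ∈ A := hx hy
      have hxA : x ∈ A := hx (mem_ball_self hδ)
      simp [hg, hyA, hxA]
    rw [hχ, convolution_eq_right' _ hKsupp h1]
    have hxA : x ∈ A := hx (mem_ball_self hδ)
    simp only [lsmul_apply, smul_eq_mul, hg, indicator_of_mem hxA, mul_one]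
    exact hKint1
  · -- `χ = 0` where the ball misses `A`
    have h1 : ∀ y ∈ ball x δ, g y = g x := by
      intro y hy
      have hyA : y ∉ A := fun h => hx.le_bot ⟨hy, h⟩
      have hxA : x ∉ A := fun h => hx.le_bot ⟨mem_ball_self hδ, h⟩
      simp [hg, hyA, hxA]
    rw [hχ, convolution_eq_right' _ hKsupp h1]
    have hxA : x ∉ A := fun h => hx.le_bot ⟨mem_ball_self hδ, h⟩
    simp [hg, indicator_of_notMem hxA]
  · -- derivative bound
    have hD := hKcs.hasFDerivAt_convolution_left (lsmul ℝ ℝ) hK1 hgli x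
    rw [hD.fderiv, convolution_def]
    set L' : (G →L[ℝ] ℝ) →L[ℝ] ℝ →L[ℝ] (G →L[ℝ] ℝ) := (lsmul ℝ ℝ).precompL G with hL'
    have hL'n : ‖L'‖ ≤ 1 :=
      (norm_precompL_le (Eₗ := G) (lsmul ℝ ℝ : ℝ →L[ℝ] ℝ →L[ℝ] ℝ)).trans opNorm_lsmul_le
    have hKd_int : Integrable (fun t => ‖fderiv ℝ K t‖) μ :=
      ((hK1.continuous_fderiv one_ne_zero).norm).integrable_of_hasCompactSupport (hKcs.fderiv ℝ).norm
    calc ‖∫ t, L' (fderiv ℝ K t) (g (x - t)) ∂μ‖ ≤ ∫ t, ‖fderiv ℝ K t‖ ∂μ := by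
          refine norm_integral_le_of_norm_le hKd_int (ae_of_all _ fun t => ?_)
          calc ‖L' (fderiv ℝ K t) (g (x - t))‖ ≤ ‖L'‖ * ‖fderiv ℝ K t‖ * ‖g (x - t)‖ := le_opNorm₂ _ _ _
            _ ≤ 1 * ‖fderiv ℝ K t‖ * 1 := by
                gcongr
                rw [Real.norm_of_nonneg (hg01 _).1]
                exact (hg01 _).2
            _ = ‖fderiv ℝ K t‖ := by ring
      _ ≤ δ⁻¹ * ∫ z, ‖fderiv ℝ ρ z‖ ∂μ := integral_norm_fderiv_scaledKernel_le hρ1' hρc hδ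
  · -- translation invariance
    have hgv : ∀ y, g (y + v) = g y := fun y => by
      by_cases hy : y ∈ A
      · simp [hg, hy, (hv y).2 hy]
      · have hy' : y + v ∉ A := fun h => hy ((hv y).1 h)
        simp [hg, hy, hy']
    have h1 : χ (x + v) = ∫ t, K t • g (x + v - t) ∂μ := convolution_lsmul
    have h2 : χ x = ∫ t, K t • g (x - t) ∂μ := convolution_lsmul
    rw [h1, h2]
    refine integral_congr_ae (ae_of_all _ fun t => ?_)
    show K t • g (x + v - t) = K t • g (x - t)
    rw [add_sub_right_comm, hgv]

/-- **Smooth cut-offs of sets at scale `δ` with `‖Dχ‖ ≤ C/δ`, inheriting the translation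
invariances of the set** (as `exists_smooth_cutoff`, with the periodicity conjunct needed to descend
a cut-off from `ℝ × ℝ^d` to `ℝ × T^d`). [cite: DeRosaIsett2024, Lemma 5.2] -/
theorem exists_smooth_cutoff_periodic (μ : Measure G) [μ.IsAddHaarMeasure] :
    ∃ C : ℝ, 0 ≤ C ∧ ∀ (A : Set G), MeasurableSet A → ∀ δ : ℝ, 0 < δ →
      ∃ χ : G → ℝ, ContDiff ℝ ∞ χ ∧ (∀ x, 0 ≤ χ x ∧ χ x ≤ 1) ∧
        (∀ x, ball x δ ⊆ A → χ x = 1) ∧ (∀ x, Disjoint (ball x δ) A → χ x = 0) ∧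
        (∀ x, ‖fderiv ℝ χ x‖ ≤ C / δ) ∧
        ∀ v : G, (∀ x, x + v ∈ A ↔ x ∈ A) → ∀ x, χ (x + v) = χ x := by
  set b : ContDiffBump (0 : G) := ⟨1 / 2, 1, by norm_num, by norm_num⟩ with hb
  set ρ : G → ℝ := b.normed μ with hρ
  refine ⟨∫ z, ‖fderiv ℝ ρ z‖ ∂μ, integral_nonneg fun _ => norm_nonneg _, fun A hA δ hδ => ?_⟩
  have hsupp : support ρ ⊆ ball 0 1 := by
    rw [hρ, b.support_normed_eq]
  obtain ⟨χ, h1, h2, h3, h4, h5, h6⟩ := exists_smooth_cutoff_of_bump_periodic (μ := μ) b.contDiff_normed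
    b.hasCompactSupport_normed hsupp (b.nonneg_normed) b.integral_normed hA hδ
  refine ⟨χ, h1, h2, h3, h4, fun x => (h5 x).trans_eq ?_, h6⟩
  rw [div_eq_inv_mul]

end Periodic

end Literature.Analysis.FunctionSpaces

end
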